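import Literature.Analysis.FluidPDE.SereginSverakBlowupRescaled
import HarnessLib

/-!
# Seregin–Šverák 2009, §4: the core of the blow-up step (centres + pressure bound ⇒ blow-up limit)

G. Seregin, V. Šverák, *On Type I singularities of the local axi-symmetric solutions of the
Navier–Stokes equations*, Comm. PDE 34 (2009) = arXiv:0804.1803, §4 (arXiv p. 11). The
selection-and-rescaling part of §4 is the same for Theorem 3.1 (Type I, (r3)) and Theorem 3.2
((r2) + (r4)); only the source of the pressure bound at the moving blow-up centres
`(x_{k,3} e₃, t_k)` differs (Lemma 3.5 + (r3), resp. Lemma 3.6 + time shifts). This file PROVES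
the shared core once:

* `blowup_of_centres` — given the standing assumptions with axial symmetry, a representative `v`
  of `u` continuous on `Q`, (p2) on `Q(1/8)`, near-maximum centres `z_k` with sizes `d_k`
  (the output of `exists_centre` of `SereginSverakBlowupSelection`), and, for the axis-centred
  rescaling with `λ_k = 1/(2‖v z_k‖)`, a bound `∫_{Q(a)} |P_k|^{3/2} ≤ c(a)` for all large `k`
  and each `a > 0`, the accepted compactness fact `BlowupCompactness` yields the blow-up limit (a
  bounded ancient weak solution in the class of KNSS, axisymmetric, `|y'| ‖w‖ ≤ C₂` a.e., not
  a.e. zero). The hypotheses of `BlowupCompactness` for the rescaled pairs are those proved in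
  `SereginSverakBlowupRescaled`; the subsequence with `y_k → y_*` is Bolzano–Weierstrass.
* `scale_sq_le` — the smallness `(aλ_k)² ≤ 1/400` for `k + 1 ≥ a²` used to keep the comparison
  radii inside the printed ranges of Lemmata 3.5–3.6.

The Type I reduction `blowupAlternativeTypeI_of_facts` is in `SereginSverakBlowupProofs`; the
Thm. 3.2 variant and the accepted `BlowupAlternative` are reduced through this core in
`SereginSverakBlowupDecay`.

## References

* G. Seregin, V. Šverák, Comm. PDE 34 (2009), arXiv:0804.1803, §4 p. 11 ((p3)–(p11)).
  [`SereginSverak2009`]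
-/

noncomputable section

open MeasureTheory Set Function Filter Topology TopologicalSpace Module
open scoped NNReal ENNReal

namespace Literature.Analysis.FluidPDE

namespace SereginSverak2009

/-- Local notation for physical space `ℝ³ = EuclideanSpace ℝ (Fin 3)`. -/
local notation "ℝ³" => EuclideanSpace ℝ (Fin 3)

/-! ### The core of §4: from selected centres and a pressure bound to the blow-up limit -/

/-- **The blow-up limit from selected centres** (§4, (p3)–(p11), arXiv p. 11, in the form fed
to `BlowupCompactness`). Let `(u, p)` satisfy the standing assumptions with axial symmetry, let
`v` be a representative of `u` continuous on `Q`, let (p2) hold on `Q(1/8)` (a.e. for `u`,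
everywhere for `v`) with constant `C₂ ≤ C₂⁺`, `0 ≤ C₂⁺`, and let centres `z_k ∈ Q(1/8)` and sizes
`d_k > 0` be given with `M_k d_k ≥ 4C₂⁺ + k + 1` (`M_k = ‖v z_k‖`), `‖v‖ ≤ 2M_k` on the backward
cylinder of size `d_k/2` about `z_k`, that cylinder inside `Q(1/8)`. If, for the axis-centred
rescaling with `λ_k = 1/(2M_k)`, the rescaled pressures satisfy `∫_{Q(a)} |P_k|^{3/2} ≤ c(a)` for
all large `k`, for each `a > 0`, then the compactness fact produces the blow-up limit: a bounded
weak solution on `ℝ³ × ]-∞, 0[`, axisymmetric, with `|y'| ‖w‖ ≤ C₂` a.e., not a.e. zero.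
[cite: SereginSverak2009, §4 (p3)–(p11) (arXiv p. 11)] -/
theorem blowup_of_centres (hF2 : BlowupCompactness) {u : ℝ → ℝ³ → ℝ³} {p : ℝ → ℝ³ → ℝ}
    {v : ℝ × ℝ³ → ℝ³} (hsol : IsAxisymmetricLocalSolution u p)
    (hvc : ContinuousOn v (parCyl 0 1)) (hvu : v =ᵐ[volume.restrict (parCyl 0 1)] uncurry u)
    {C₂ C₂' : ℝ}
    (hC₂ : ∀ᵐ z ∂(volume.restrict (parCyl 0 (1 / 8))), cylRadius z.2 * ‖u z.1 z.2‖ ≤ C₂)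
    (hp2v : ∀ z ∈ parCyl 0 (1 / 8), cylRadius z.2 * ‖v z‖ ≤ C₂) (hC₂le : C₂ ≤ C₂')
    (hC₂'0 : 0 ≤ C₂') {zc : ℕ → ℝ × ℝ³} {d : ℕ → ℝ} (hzQ : ∀ k, zc k ∈ parCyl 0 (1 / 8))
    (hdpos : ∀ k, 0 < d k) (hN : ∀ k : ℕ, 4 * C₂' + k + 1 ≤ ‖v (zc k)‖ * d k)
    (hbd : ∀ k, ∀ z ∈ backCyl (zc k) (d k / 2), ‖v z‖ ≤ 2 * ‖v (zc k)‖)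
    (hback : ∀ k, backCyl (zc k) (d k / 2) ⊆ parCyl 0 (1 / 8))
    (hpress : ∀ a : ℝ, 0 < a → ∃ cst : ℝ≥0, ∀ᶠ k : ℕ in atTop,
      ∫⁻ z in parCyl 0 a, ‖((1 / (2 * ‖v (zc k)‖)) ^ 2 •
        stPull ((1 / (2 * ‖v (zc k)‖)) ^ 2) (1 / (2 * ‖v (zc k)‖)) (zc k).1 ((zc k).2 2 • eZ) p)
          z.1 z.2‖ₑ ^ (3 / 2 : ℝ) ≤ cst) :
    ∃ w : ℝ → ℝ³ → ℝ³, IsBoundedWeakNSSolutionOn (Iio 0) isOpen_Iio 1 w ∧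
      (∀ θ : ℝ, ∀ᵐ t ∂(volume.restrict (Iio (0 : ℝ))),
        (fun x => w t (rotZ θ x)) =ᵐ[volume] fun x => rotZ θ (w t x)) ∧
      (∀ᵐ t ∂(volume.restrict (Iio (0 : ℝ))), ∀ᵐ x ∂(volume : Measure ℝ³),
        cylRadius x * ‖w t x‖ ≤ C₂) ∧
      ¬ (∀ᵐ t ∂(volume.restrict (Iio (0 : ℝ))), w t =ᵐ[volume] 0) := by
  have h18 : parCyl (0 : ℝ × ℝ³) (1 / 8) ⊆ parCyl 0 1 := parCyl_mono 0 (by norm_num) (by norm_num)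
  -- the scalars `M_k = ‖v z_k‖`, `c_k = λ_k = 1/(2 M_k)`, `R_k = M_k d_k - 2 C₂⁺`
  set M : ℕ → ℝ := fun k => ‖v (zc k)‖ with hM
  have hMd : ∀ k : ℕ, 4 * C₂' + k + 1 ≤ M k * d k := hN
  have hMpos : ∀ k, 0 < M k := fun k => by
    have h1 := hMd k
    by_contra h
    push Not at h
    have h2 : M k * d k ≤ 0 := mul_nonpos_of_nonpos_of_nonneg h (hdpos k).le
    have h3 : (0 : ℝ) ≤ k := Nat.cast_nonneg k
    linarith
  set c : ℕ → ℝ := fun k => 1 / (2 * M k) with hc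
  have hcpos : ∀ k, 0 < c k := fun k => by
    have := hMpos k
    positivity
  have hcM : ∀ k, c k * M k = 1 / 2 := fun k => by
    have := (hMpos k).ne'
    simp only [hc]
    field_simp
  have hcinv : ∀ k, (c k)⁻¹ = 2 * M k := fun k => by simp [hc]
  set R : ℕ → ℝ := fun k => M k * d k - 2 * C₂' with hR
  have hRge : ∀ k : ℕ, (k : ℝ) + 1 ≤ R k := fun k => by
    have h1 := hMd k
    simp only [hR]
    linarith
  have hRpos : ∀ k, 0 < R k := fun k => by
    have h1 := hRge k
    have h3 : (0 : ℝ) ≤ k := Nat.cast_nonneg k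
    linarith
  have hRtend : Tendsto R atTop atTop :=
    tendsto_atTop_mono hRge (tendsto_atTop_add_const_right _ 1 tendsto_natCast_atTop_atTop)
  -- `y_k = c_k⁻¹ x_k'`, `|y_k| = 2 M_k |x_k'| ≤ 2 C₂` by (p2) at `z_k`
  have hyrad : ∀ k, cylRadius ((c k)⁻¹ • horiz (zc k).2) ≤ 2 * C₂' := fun k => by
    have h1 := hp2v (zc k) (hzQ k)
    rw [cylRadius_inv_smul_horiz (hcpos k), hcinv k]
    have h2 : 0 ≤ cylRadius (zc k).2 := cylRadius_nonneg _
    calc 2 * M k * cylRadius (zc k).2 = 2 * (cylRadius (zc k).2 * ‖v (zc k)‖) := by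
          simp only [hM]; ring
      _ ≤ 2 * C₂' := by linarith
  have hynorm : ∀ k, ‖(c k)⁻¹ • horiz (zc k).2‖ ≤ 2 * C₂' := fun k => by
    rw [norm_inv_smul_horiz (hcpos k), ← cylRadius_inv_smul_horiz (hcpos k)]
    exact hyrad k
  -- `Φ_k` maps `Q(0, R_k)` into the controlled backward cylinder
  have hRσ : ∀ k, R k + cylRadius ((c k)⁻¹ • horiz (zc k).2) ≤ (d k / 2) / c k := fun k => by
    have e : (d k / 2) / c k = M k * d k := by
      rw [div_eq_mul_inv, hcinv k]
      ring
    rw [e]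
    have h1 := hyrad k
    simp only [hR]
    linarith
  have hbackQ : ∀ k, backCyl (zc k) (d k / 2) ⊆ parCyl 0 1 := fun k => (hback k).trans h18
  have hmapsQ : ∀ k, parCyl 0 (R k) ⊆
      stAffine (c k ^ 2) (c k) (zc k).1 ((zc k).2 2 • eZ) ⁻¹' parCyl 0 1 :=
    fun k => parCyl_subset_preimage_stAffine (hcpos k) (zc k) (hRσ k) (hbackQ k)
  have hmaps8 : ∀ k, parCyl 0 (R k) ⊆
      stAffine (c k ^ 2) (c k) (zc k).1 ((zc k).2 2 • eZ) ⁻¹' parCyl 0 (1 / 8) :=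
    fun k => parCyl_subset_preimage_stAffine (hcpos k) (zc k) (hRσ k) (hback k)
  -- `v ∘ Φ_k = u ∘ Φ_k` a.e. on `Q(0, R_k)`
  have hae : ∀ k, ∀ᵐ z ∂(volume.restrict (parCyl 0 (R k))),
      v (stAffine (c k ^ 2) (c k) (zc k).1 ((zc k).2 2 • eZ) z) =
        uncurry u (stAffine (c k ^ 2) (c k) (zc k).1 ((zc k).2 2 • eZ) z) := fun k =>
    ae_restrict_of_ae_restrict_of_subset (hmapsQ k)
      (ae_restrict_preimage_stAffine (sq_pos_of_pos (hcpos k)) (hcpos k) _ _ hvu)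
  -- the hypotheses of `BlowupCompactness`, for every `k`
  have hdist : ∀ k, IsDistributionalNSSolutionOn (parCylOpens 0 (R k)) 1 0
      (c k • stPull (c k ^ 2) (c k) (zc k).1 ((zc k).2 2 • eZ) u)
      (c k ^ 2 • stPull (c k ^ 2) (c k) (zc k).1 ((zc k).2 2 • eZ) p) :=
    fun k => isDistributional_rescaled hsol.distributional (hcpos k) _ _ (hmapsQ k)
  have hbound : ∀ k, ∀ᵐ z ∂(volume.restrict (parCyl 0 (R k))),
      ‖(c k • stPull (c k ^ 2) (c k) (zc k).1 ((zc k).2 2 • eZ) u) z.1 z.2‖ ≤ 1 := fun k =>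
    ae_norm_rescaled_le_one (hcpos k) (zc k) (hRσ k) (hbd k)
      (by rw [hM] at hcM; nlinarith [hcM k]) (hae k)
  have haxi : ∀ k, ∀ s ∈ Ioo (-R k ^ 2) 0,
      IsAxisymmetric ((c k • stPull (c k ^ 2) (c k) (zc k).1 ((zc k).2 2 • eZ) u) s) :=
    fun k s hs => isAxisymmetric_rescaled_slice hsol.axisymmetric (hRpos k) (zc k) (hmapsQ k) hs
  have hdecay : ∀ k, ∀ᵐ z ∂(volume.restrict (parCyl 0 (R k))),
      cylRadius z.2 * ‖(c k • stPull (c k ^ 2) (c k) (zc k).1 ((zc k).2 2 • eZ) u) z.1 z.2‖ ≤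
        C₂ :=
    fun k => ae_decay_rescaled (hcpos k) (zc k) hC₂ (hmaps8 k)
  have hcont : ∀ k, ∃ V : ℝ × ℝ³ → ℝ³, ContinuousOn V (parCylTop (R k)) ∧
      V =ᵐ[volume.restrict (parCyl 0 (R k))]
        uncurry (c k • stPull (c k ^ 2) (c k) (zc k).1 ((zc k).2 2 • eZ) u) ∧
      (c k)⁻¹ • horiz (zc k).2 ∈ spaceCyl 0 (R k) ∧
      (1 / 2 : ℝ) ≤ ‖V (0, (c k)⁻¹ • horiz (zc k).2)‖ := by
    intro k
    refine ⟨fun z => c k • v (stAffine (c k ^ 2) (c k) (zc k).1 ((zc k).2 2 • eZ) z),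
      continuousOn_rescaled hvc (hcpos k) (zc k) (hRσ k) (hbackQ k), ?_, ?_, ?_⟩
    · filter_upwards [hae k] with z hz
      simp only [uncurry, smul_stPull_apply]
      rw [hz]
      rfl
    · rw [mem_spaceCyl, sub_zero]
      refine ⟨lt_of_le_of_lt (hyrad k) ?_, ?_⟩
      · have h1 := hMd k
        have h3 : (0 : ℝ) ≤ k := Nat.cast_nonneg k
        simp only [hR]
        linarith
      · simpa using hRpos k
    · simp only
      rw [stAffine_zero_inv_smul_horiz (hcpos k).ne', norm_smul, Real.norm_eq_abs,
        abs_of_pos (hcpos k)]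
      exact (hcM k).symm.le
  -- a subsequence with `y_k → y_*` (Bolzano–Weierstrass), and the compactness step
  obtain ⟨yStar, -, φ, hφ, hφy⟩ := tendsto_subseq_of_bounded
    (Metric.isBounded_closedBall (x := (0 : ℝ³)) (r := 2 * C₂'))
    (x := fun k => (c k)⁻¹ • horiz (zc k).2) (fun k => mem_closedBall_zero_iff.2 (hynorm k))
  exact hF2
    (fun k => c (φ k) • stPull (c (φ k) ^ 2) (c (φ k)) (zc (φ k)).1 ((zc (φ k)).2 2 • eZ) u)
    (fun k => c (φ k) ^ 2 • stPull (c (φ k) ^ 2) (c (φ k)) (zc (φ k)).1 ((zc (φ k)).2 2 • eZ) p)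
    (fun k => R (φ k)) (fun k => (c (φ k))⁻¹ • horiz (zc (φ k)).2) yStar C₂ (1 / 2)
    (hRtend.comp hφ.tendsto_atTop) hφy (by norm_num)
    (fun k => hdist (φ k)) (fun k => hbound (φ k)) (fun k => haxi (φ k))
    (fun k => hdecay (φ k))
    (fun a ha => by
      obtain ⟨cst, hcst⟩ := hpress a ha
      exact ⟨cst, hφ.tendsto_atTop.eventually hcst⟩)
    (fun k => hcont (φ k))

/-- Smallness of the blow-up scale along the selection: `M_k d_k ≥ k + 1` and `d_k ≤ 1/10` give
`λ_k = 1/(2M_k) ≤ 1/(20(k+1))`, so that `(aλ_k)² ≤ 1/400` once `k + 1 ≥ a²`. [folklore] -/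
theorem scale_sq_le {Mk dk a : ℝ} {k : ℕ} (hdpos : 0 < dk) (hdle : dk ≤ 1 / 10)
    (hN : (k : ℝ) + 1 ≤ Mk * dk) (hk : a ^ 2 ≤ (k : ℝ) + 1) (ha : 0 ≤ a) :
    (a * (1 / (2 * Mk))) ^ 2 ≤ 1 / 400 := by
  have hk0 : (0 : ℝ) ≤ k := Nat.cast_nonneg k
  have hMpos : 0 < Mk := by
    by_contra h
    push Not at h
    have h2 : Mk * dk ≤ 0 := mul_nonpos_of_nonpos_of_nonneg h hdpos.le
    linarith
  have hMge : 10 * ((k : ℝ) + 1) ≤ Mk := by nlinarith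
  set ck := 1 / (2 * Mk) with hck
  have hcpos : 0 < ck := by positivity
  have hcM : ck * (2 * Mk) = 1 := by
    simp only [hck]
    field_simp
  have hcle : ck * (20 * ((k : ℝ) + 1)) ≤ 1 := by
    have h2 : ck * (20 * ((k : ℝ) + 1)) ≤ ck * (2 * Mk) :=
      mul_le_mul_of_nonneg_left (by linarith) hcpos.le
    linarith
  have h1 : a * ck * (20 * ((k : ℝ) + 1)) ≤ a := by nlinarith
  have h2 : (a * ck) ^ 2 * (400 * ((k : ℝ) + 1) ^ 2) ≤ a ^ 2 := by
    have h0 : 0 ≤ a * ck * (20 * ((k : ℝ) + 1)) := by positivity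
    nlinarith
  have h3 : a ^ 2 ≤ ((k : ℝ) + 1) ^ 2 := by nlinarith
  have h4 : 0 < ((k : ℝ) + 1) ^ 2 := by positivity
  by_contra h5
  push Not at h5
  nlinarith

end SereginSverak2009

end Literature.Analysis.FluidPDE
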